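import Literature.Computability.AlgebraicComplexity.ObstructionTypes
import Literature.Computability.AlgebraicComplexity.MultiplicityObstructionsProofs
import Literature.Computability.Complexity.OccurrenceObstructionsHookTableaux
import Literature.Computability.Complexity.OccurrenceObstructionsDischarge
import Mathlib.RingTheory.RootsOfUnity.Complex
import HarnessLib

/-!
# No occurrence obstructions for (border) Waring rank: BIP Cor. 2.6 discharged

Topic `Literature/Computability/AlgebraicComplexity`, sibling proof file (D-0014) of
`ObstructionTypes.lean`, whose one named fact `bip2019_cor_2_6` (Bürgisser–Ikenmeyer–Panova,
J. AMS 32 (2019) = arXiv:1604.06431v3, Cor. 2.6: "Let `n, d, m` be positive integers with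
`n ≥ m^25` and `λ ⊢ nd`. If `λ` occurs in `ℂ[Z_{n,m}]`, then `λ` also occurs in `ℂ[PS_n]`") is
proved here as `bip2019_cor_2_6_holds`; theorems only, no definition, no statement of the tree is
changed.

## The printed proof, and how it is followed

BIP §2(d) ("No occurrence obstructions for Waring rank", J. AMS p. 170 = arXiv v3 p. 7; loci
below are lines of the arXiv v3 source `1604.06431/main.tex` held by the pub-gct cell): "The only
information used about the orbit closure of the determinant `Ω_n` in the proof of our main result
is that it contains certain padded power sums (Theorem 2.5)" (l. 859–860); for the power sums
`p = φ_1^s + ⋯ + φ_k^s` met in the proof "we have that `R(p) ≤ k` and `R(X_1^{n-s} p) ≤ nk ≤ n²`,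
so `X_1^{n-s} p ∈ PS_n` and hence `λ` occurs in `ℂ[PS_n]_d`. Hence we can replace `Ω_n` by `PS_n`
and obtain the following result" (l. 866–872; Cor. 2.6 = l. 874–878). The printed sentence names
Props. 2.4 and 6.1 as the places where `Ω_n` enters; the proof of Thm. 1.4 also evaluates
highest weight vectors at padded power sums in §6(a) (`(n)` occurs: `X_1^n ∈ Ω_n`), §6(b)
(Prop. 2.3) and §7 (Thm. 6.2) — all instances of Thm. 2.5, so the corollary stands, and the formal
proof below treats all five places uniformly. Accordingly this file

* (§1–§6) re-runs the tree's proof of BIP Thm. 1.4 (`Complexity.bip2019_prop_2_4_of_parts`,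
  `…prop_6_1_of_parts`, `…prop_2_3_holds`, `…thm_6_2_holds`, `…prop_6_3_of_parts`,
  `…hasHighestWeight_detOrbitRep_of_parts`, `…bip2019_no_occurrence_obstructions_of_parts`, files
  `Complexity/OccurrenceObstructionsBIP.lean`, `…HookTableaux.lean`) VERBATIM for an arbitrary
  nonzero form `f` of degree `m` in the `m²` matrix variables whose orbit closure contains the
  padded power sums `X_{iₘ}^{m-s}(φ_1^s + ⋯ + φ_r^s)`, `s r ≤ m` (`iₘ` the greatest matrix index) —
  the three determinant-specific lemmas of those proofs
  (`Complexity.X_pow_mul_sum_linearFormPow_mem_orbitClosure_detFormLex` = Thm. 2.5,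
  `Complexity.aeval_formCoeff_eq_zero_of_mem_orbitClosure_detFormLex`,
  `Complexity.X_single_top_not_mem_orbitVanishingIdeal_detFormLex` /
  `Complexity.hasHighestWeight_detOrbitRep_single_top`) being replaced by that hypothesis; every
  other ingredient (Thm. 2.1, Lemma 2.2, Prop. 3.2, Props. 5.6(2), 5.8(2), the hyperdeterminant
  and hook tableaux of §6(b)/§7, the splitting technique, the BLMW lift) is the tree's theorem,
  used as is;
* (§7) proves that `PS_m = \overline{GL_{m²} · (X_1^m + ⋯ + X_{m²}^m)}` (`psFormLex`,
  `ObstructionTypes.lean`) contains those padded power sums, by an explicit Waring decomposition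
  with at most `m²` terms (`X^{m-s} φ^s = (m \binom{m}{s})^{-1} ∑_{j<m} ζ^{j(m-s)} (X + ζ^j φ)^m`,
  `ζ` a primitive `m`-th root of unity, `1 ≤ s ≤ m - 1`; `r ≤ m` terms `φ_i` — the printed
  "`R(X_1^{n-s} p) ≤ nk ≤ n²`", arXiv v3 source l. 868), and the tree's `End · f ⊆ Δ[f]`
  (`endOrbit_subset_orbitClosure_holds`);
* (§8) assembles `bip2019_cor_2_6_holds`;
* (§9) records the two census statements of `ObstructionTypes.lean` ("what remains after BIP":
  every multiplicity obstruction against BIP's padded permanent in `Δ(det_m)`, resp. in `PS_m`, is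
  a vanishing ideal occurrence obstruction or a pure multiplicity obstruction, `0 < n`,
  `n ^ 25 ≤ m`) UNCONDITIONALLY, their named-fact hypotheses being the tree's theorems
  `Complexity.bip2019_no_occurrence_obstructions_holds` / `bip2019_cor_2_6_holds`,
  `finiteDimensional_highestWeightSpace_orbitCoordRep_holds`, `orbitMultiplicity_le_plethysmCoeff_holds`.

Letters as in `ObstructionTypes.lean` / `OccurrenceObstructionsBIP.lean`: permanent size `n`,
power-sum / target size `m`, threshold `n ^ 25 ≤ m`, weight form, BIP's own padded permanent
`Complexity.bipPaddedPerOrbitRep`. Honest scope: a no-go theorem about OCCURRENCE obstructions in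
the power-sum model, as printed; nothing here bears on multiplicity obstructions, VP vs VNP or
P vs NP.

## References

* P. Bürgisser, C. Ikenmeyer, G. Panova, *No occurrence obstructions in geometric complexity
  theory*, J. Amer. Math. Soc. 32 (2019) 163–193 = arXiv:1604.06431v3: §2(d), Cor. 2.6, Thm. 2.5,
  Props. 2.3, 2.4, 6.1, Thm. 6.2, Prop. 6.3, §6 (Proof of Theorem 1.4), §7.
  [BurgisserIkenmeyerPanovaJAMS2019]

Provenance: pub-gct-max cell, seat lit-2 (typed chain, track T); discharge of the one BIP
statement of the tree carried as a named fact (typed/AS-PRINTED-2.md row A12).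
-/

noncomputable section

open MvPolynomial Finset

namespace Literature.Computability.AlgebraicComplexity

open _root_.Literature.NumberTheory.DiophantineGeometry

/-! ## §0. A target orbit closure containing the padded power sums: the two generic principles -/

section Target

variable {m : ℕ} {f : MvPolynomial (MatIdx m) ℂ}

/-- Every polynomial of the vanishing ideal of the orbit `GL_{m²} · f` of a nonzero form `f` of
degree `m` vanishes at every point of the orbit CLOSURE `Δ[f]` (the tree's
`mem_orbitClosure_iff_formCoeff_holds`); generic form of
`Complexity.aeval_formCoeff_eq_zero_of_mem_orbitClosure_detFormLex`. BIP §3(b) (a highest weight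
vector "viewed as a degree `d` polynomial function" vanishing on the orbit vanishes on its
closure). [cite: BurgisserIkenmeyerPanovaJAMS2019, §3(b)] -/
theorem aeval_formCoeff_eq_zero_of_mem_orbitClosure_of_mem (hf : f.IsHomogeneous m) (hf0 : f ≠ 0)
    {q : MvPolynomial (MatIdx m) ℂ} (hq : q ∈ orbitClosure f)
    {F : MvPolynomial (DegIdx (MatIdx m) m) ℂ} (hF : F ∈ orbitVanishingIdeal f m) :
    aeval (formCoeff m q) F = 0 := by
  have h := ((mem_orbitClosure_iff_formCoeff_holds hf hf0).mp hq).2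
  rw [MvPolynomial.mem_zeroLocus_iff] at h
  exact h F hF

/-- A single variable as a "linear combination of the variables": `∑_x [x = i] X_x = X_i`.
[folklore] -/
private theorem sum_C_ite_mul_X_eq (i : MatIdx m) :
    (∑ x, C (if x = i then (1 : ℂ) else 0) * X x : MvPolynomial (MatIdx m) ℂ) = X i := by
  classical
  rw [Finset.sum_eq_single i]
  · simp
  · intro x _ hx; simp [hx]
  · exact fun h => absurd (Finset.mem_univ _) h

/-- If the orbit closure of `f` contains the padded power sums `X_{iₘ}^{m-s}(φ_1^s + ⋯ + φ_r^s)`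
(`s r ≤ m`), then it contains `X_{iₘ}^m` (the case `s = m`, `r = 1`, `φ_1 = X_{iₘ}`). BIP §6(a)
("we have `X_1^n ∈ Ω_n`"), generic form. [cite: BurgisserIkenmeyerPanovaJAMS2019, §6(a)] -/
theorem X_pow_mem_orbitClosure_of_paddedPowerSums (iₘ : MatIdx m)
    (hps : ∀ (s r : ℕ), s * r ≤ m → ∀ φ : Fin r → MatIdx m → ℂ,
      (X iₘ ^ (m - s) * ∑ i, (∑ x, C (φ i x) * X x : MvPolynomial (MatIdx m) ℂ) ^ s) ∈
        orbitClosure f) :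
    (X iₘ ^ m : MvPolynomial (MatIdx m) ℂ) ∈ orbitClosure f := by
  classical
  have h := hps m 1 (by rw [mul_one]) (fun _ x => if x = iₘ then 1 else 0)
  simpa [sum_C_ite_mul_X_eq] using h

/-- **The coordinate of `x_{iₘ}^m` does not vanish on the orbit of `f`** whenever `Δ[f]` contains
the padded power sums (generic form of
`Complexity.X_single_top_not_mem_orbitVanishingIdeal_detFormLex`): it takes the value `1` at the
point `X_{iₘ}^m ∈ Δ[f]`. BIP §6(a) ("`⟨e_{11}^n, X_1^n⟩ = 1`").
[cite: BurgisserIkenmeyerPanovaJAMS2019, §6(a)] -/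
theorem X_single_not_mem_orbitVanishingIdeal_of_paddedPowerSums (hf : f.IsHomogeneous m)
    (hf0 : f ≠ 0) (iₘ : MatIdx m)
    (hps : ∀ (s r : ℕ), s * r ≤ m → ∀ φ : Fin r → MatIdx m → ℂ,
      (X iₘ ^ (m - s) * ∑ i, (∑ x, C (φ i x) * X x : MvPolynomial (MatIdx m) ℂ) ^ s) ∈
        orbitClosure f)
    (d : DegIdx (MatIdx m) m) (hd : d.1 = Finsupp.single iₘ m) :
    (X d : MvPolynomial (DegIdx (MatIdx m) m) ℂ) ∉ orbitVanishingIdeal f m := by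
  classical
  intro hI
  have h0 := aeval_formCoeff_eq_zero_of_mem_orbitClosure_of_mem hf hf0
    (X_pow_mem_orbitClosure_of_paddedPowerSums iₘ hps) hI
  rw [aeval_X, formCoeff_apply, hd, coeff_X_pow, if_pos rfl] at h0
  exact one_ne_zero h0

/-- **`(m)` occurs in `k[Δ[f]]_1`** whenever `Δ[f]` contains the padded power sums (generic form
of `Complexity.hasHighestWeight_detOrbitRep_single_top`, BIP §6(a): "`e_{11}^n ∈ Sym^n V` is a
highest weight vector of weight `(n)` such that `⟨e_{11}^n, X_1^n⟩ = 1`"), weight form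
`-m ε_{iₘ}`, `iₘ` the greatest index. [cite: BurgisserIkenmeyerPanovaJAMS2019, §6(a)] -/
theorem hasHighestWeight_orbitCoordRep_single_top_of_paddedPowerSums (hf : f.IsHomogeneous m)
    (hf0 : f ≠ 0) (iₘ : MatIdx m) (hiₘ : ∀ i, i ≤ iₘ)
    (hps : ∀ (s r : ℕ), s * r ≤ m → ∀ φ : Fin r → MatIdx m → ℂ,
      (X iₘ ^ (m - s) * ∑ i, (∑ x, C (φ i x) * X x : MvPolynomial (MatIdx m) ℂ) ^ s) ∈
        orbitClosure f) :
    HasHighestWeight (orbitCoordRep f m) (Pi.single iₘ (-(m : ℤ))) := by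
  classical
  have hdeg : (Finsupp.single iₘ m : MatIdx m →₀ ℕ) ∈ degMonomials (MatIdx m) m := by
    rw [mem_degMonomials_iff, Finsupp.degree_single]
  exact Complexity.hasHighestWeight_orbitCoordRep_of_not_mem f m
    (Complexity.X_mem_highestWeightSpace_coordRep m iₘ hiₘ ⟨Finsupp.single iₘ m, hdeg⟩ rfl)
    (X_single_not_mem_orbitVanishingIdeal_of_paddedPowerSums hf hf0 iₘ hps _ rfl)

end Target

/-! ## §1–§6. BIP's proof of Thm. 1.4, re-run for a target orbit closure `Δ[f]` containing the
padded power sums (BIP §2(d): "The only information used about the orbit closure of the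
determinant `Ω_n` in the proof of our main result is that it contains certain padded power sums
(Theorem 2.5)")

Throughout: `f` a nonzero form of degree `m` in the `m²` lexicographic matrix variables
`MatIdx m`, `iₘ = topMatIdx m` the greatest index, and the hypothesis
`hps : ∀ s r, s r ≤ m → X_{iₘ}^{m-s} (φ_1^s + ⋯ + φ_r^s) ∈ Δ[f]` for all linear forms `φ_i`. The
proofs are those of `Complexity.bip2019_prop_2_4_of_parts`, `Complexity.bip2019_prop_6_1_of_parts`,
`Complexity.bip2019_prop_2_3_holds`, `Complexity.bip2019_thm_6_2_holds`,
`Complexity.bip2019_prop_6_3_of_parts`, `Complexity.hasHighestWeight_detOrbitRep_of_parts` and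
`Complexity.bip2019_no_occurrence_obstructions_of_parts`, verbatim up to the three
determinant-specific lemma calls, which become `hps` (§0). -/

section GenericTarget

open _root_.Literature.Computability.Complexity

variable {m : ℕ} [NeZero m] {f : MvPolynomial (MatIdx m) ℂ}

/-- **BIP Prop. 2.4 (small degrees) for a target containing the padded power sums.** "Let
`λ ⊢ nd` be such that there exists a positive integer `m` satisfying `|λ̄| ≤ md` and `md² ≤ n`.
Then every highest weight vector of weight `λ` in `Sym^d Sym^n V`, viewed as a degree `d`
polynomial function on `Sym^n V^*`, does not vanish on `Ω_n`" — with `Ω_n` replaced by any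
`Δ[f] ⊇` padded power sums (§2(d)); letters and rendering of `Complexity.bip2019_prop_2_4`
(target size `m`, auxiliary `M`), proof of `Complexity.bip2019_prop_2_4_of_parts` (Prop. 5.6(2),
Prop. 3.2, the lifting Thm. 5.4 / Lemma 5.2, evaluation at `X_{iₘ}^{m-Md}(φ_1^{Md} + ⋯ + φ_d^{Md})`).
[cite: BurgisserIkenmeyerPanovaJAMS2019, Prop. 2.4, §6(a) and §2(d)] -/
theorem not_mem_orbitVanishingIdeal_of_small_degree_of_paddedPowerSums (hf : f.IsHomogeneous m)
    (hf0 : f ≠ 0)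
    (hps : ∀ (s r : ℕ), s * r ≤ m → ∀ φ : Fin r → MatIdx m → ℂ,
      (X (topMatIdx m) ^ (m - s) * ∑ i, (∑ x, C (φ i x) * X x : MvPolynomial (MatIdx m) ℂ) ^ s) ∈
        orbitClosure f)
    {d M : ℕ} (hd : 0 < d) (hM : 0 < M) (lam : Nat.Partition (d * m))
    (hlam : lam.parts.card ≤ m * m) (hbody : bodySize lam ≤ M * d) (hMd : M * d ^ 2 ≤ m)
    (v : MvPolynomial (DegIdx (MatIdx m) m) ℂ)
    (hv : v ∈ highestWeightSpace (coordRep (MatIdx m) ℂ m) (partitionWeightLex m lam))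
    (hv0 : v ≠ 0) :
    v ∉ orbitVanishingIdeal f m := by
  classical
  have hm0 : m ≠ 0 := NeZero.ne m
  set iₘ := topMatIdx m with hiₘ'
  have hiₘ : ∀ i, i ≤ iₘ := le_topMatIdx m
  -- a weight pins the degree: `v` is a form of degree `d`
  have hvd : v.IsHomogeneous d :=
    AlgebraicComplexity.isHomogeneous_of_mem_highestWeightSpace hm0 hv (size_partitionWeightLex lam hlam)
  by_cases hd1 : d = 1
  · -- degree one: `v = c X_{x_{iₘ}^m}`
    subst hd1
    obtain ⟨e, c, hc, rfl⟩ := AlgebraicComplexity.exists_eq_smul_X_of_mem_weightSpace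
      (Literature.NumberTheory.DiophantineGeometry.highestWeightSpace_le_weightSpace _ _ hv) hvd hv0
    have he := AlgebraicComplexity.eq_single_of_smul_X_mem_highestWeightSpace iₘ hiₘ hc hv
    intro hI
    have hX : (X e : MvPolynomial (AlgebraicComplexity.DegIdx (Literature.NumberTheory.DiophantineGeometry.MatIdx m) m) ℂ) ∈
        orbitVanishingIdeal f m := by
      have := Ideal.mul_mem_left _ (C c⁻¹) hI
      rwa [smul_eq_C_mul, ← mul_assoc, ← map_mul, inv_mul_cancel₀ hc, map_one, one_mul] at this
    exact X_single_not_mem_orbitVanishingIdeal_of_paddedPowerSums hf hf0 iₘ hps e he hX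
  · -- `d ≥ 2`: lift from inner degree `M d`
    have hd2 : 2 ≤ d := by omega
    have hm'm : M * d ≤ m := le_trans (by rw [sq]; exact Nat.mul_le_mul_left _ (by nlinarith)) hMd
    have h₂ : secondPart lam ≤ M * d := (secondPart_le_bodySize lam).trans hbody
    have hb2 : secondPart lam + bodySize lam ≤ M * d * d := by
      have h1 := secondPart_le_bodySize lam
      have h2 : 2 * (M * d) ≤ M * d * d := by nlinarith
      omega
    obtain ⟨mu, fv, -, -, hfd, hfw, hvf⟩ := bip2019_prop_5_6_2_holds m (M * d) m d hm'm lam hlam h₂ hb2 v hvd hv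
    have hfv0 : fv ≠ 0 := by
      rintro rfl
      exact hv0 (by rw [hvf, map_zero])
    -- `fv ∘ Δ`
    obtain ⟨F, hF⟩ : ∃ F : MvPolynomial (AlgebraicComplexity.DegIdx (Literature.NumberTheory.DiophantineGeometry.MatIdx m) (M * d)) ℂ,
        F = aeval (fun e : AlgebraicComplexity.DegIdx (Literature.NumberTheory.DiophantineGeometry.MatIdx m) (M * d) =>
          C (((e.1 iₘ + (m - M * d)).descFactorial (m - M * d) : ℕ) : ℂ) * X e) fv := ⟨_, rfl⟩
    have hsupp := AlgebraicComplexity.support_aeval_C_mul_X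
      (fun e : AlgebraicComplexity.DegIdx (Literature.NumberTheory.DiophantineGeometry.MatIdx m) (M * d) =>
        (((e.1 iₘ + (m - M * d)).descFactorial (m - M * d) : ℕ) : ℂ))
      (fun e => Nat.cast_ne_zero.mpr (AlgebraicComplexity.descFactorial_add_pos _ _).ne') fv
    rw [← hF] at hsupp
    have hF0 : F ≠ 0 := by
      intro h0
      apply hfv0
      rw [← support_eq_empty, ← hsupp, h0, support_zero]
    have hFdeg : F.totalDegree ≤ d :=
      (totalDegree_le_of_support_subset hsupp.le).trans (hfd.totalDegree hfv0).le
    -- Prop. 3.2: a power sum with `d` terms on which `fv ∘ Δ` does not vanish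
    have hm'pos : 0 < M * d := Nat.mul_pos hM hd
    obtain ⟨φ, hφ⟩ := AlgebraicComplexity.exists_aeval_formCoeff_sum_linearFormPow_ne_zero hm'pos F hF0 hFdeg
    obtain ⟨p, hp⟩ : ∃ p : MvPolynomial (Literature.NumberTheory.DiophantineGeometry.MatIdx m) ℂ,
        p = ∑ i, (∑ x, C (φ i x) * X x) ^ (M * d) := ⟨_, rfl⟩
    have hphom : p.IsHomogeneous (M * d) := by
      rw [hp]
      exact Complexity.isHomogeneous_sum_linearFormPow φ (M * d)
    -- the padded power sum `q = X_{iₘ}^{m - M * d} p ∈ Δ[f]` (hypothesis `hps`)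
    obtain ⟨q, hq⟩ : ∃ q : MvPolynomial (Literature.NumberTheory.DiophantineGeometry.MatIdx m) ℂ, q = X iₘ ^ (m - M * d) * p := ⟨_, rfl⟩
    have hqhom : q.IsHomogeneous m := by
      have := (isHomogeneous_X_pow (R := ℂ) iₘ (m - M * d)).mul hphom
      rwa [Nat.sub_add_cancel hm'm, ← hq] at this
    have hqmem : q ∈ orbitClosure f := by
      have hsr : M * d * d ≤ m := by rw [mul_assoc, ← sq]; exact hMd
      rw [hq, hp]
      exact hps (M * d) d hsr φ
    -- `v(q) = fv(∂^{m-m'} q) = (fv ∘ Δ)(p) ≠ 0`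
    have hvq : aeval (AlgebraicComplexity.formCoeff m q) v ≠ 0 := by
      rw [hvf, AlgebraicComplexity.aeval_formCoeff_innerLift iₘ hqhom, hq,
        AlgebraicComplexity.aeval_formCoeff_iterPderiv_X_pow_mul iₘ (m - M * d) hphom, ← hF, hp]
      exact hφ
    intro hvI
    exact hvq (aeval_formCoeff_eq_zero_of_mem_orbitClosure_of_mem hf hf0 hqmem hvI)

/-- **BIP Prop. 6.1 (extremely long first rows) for a target containing the padded power sums.**
"Let `λ ⊢ nd` and assume there exist positive integers `s, m` such that `ℓ(λ) ≤ m²`, `λ₂ ≤ s`,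
`m² s² ≤ n`, and `m² s ≤ d`. Then every highest weight vector `h ∈ Sym^d Sym^n V` of weight `λ`,
viewed as a degree `d` polynomial function on `Sym^n V^*`, does not vanish on `Ω_n`" — with `Ω_n`
replaced by any `Δ[f] ⊇` padded power sums (§2(d)); rendering of `Complexity.bip2019_prop_6_1`,
proof of `Complexity.bip2019_prop_6_1_of_parts` (Props. 5.6(2), 5.8(2), Prop. 3.2 two-at-once,
evaluation at `X_{iₘ}^{m-s}(φ_1^s + ⋯ + φ_{M²s}^s)`).
[cite: BurgisserIkenmeyerPanovaJAMS2019, Prop. 6.1, §6(a) and §2(d)] -/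
theorem not_mem_orbitVanishingIdeal_of_long_first_row_of_paddedPowerSums
    (hf : f.IsHomogeneous m) (hf0 : f ≠ 0)
    (hps : ∀ (s r : ℕ), s * r ≤ m → ∀ φ : Fin r → MatIdx m → ℂ,
      (X (topMatIdx m) ^ (m - s) * ∑ i, (∑ x, C (φ i x) * X x : MvPolynomial (MatIdx m) ℂ) ^ s) ∈
        orbitClosure f)
    {d s M : ℕ} (hs : 0 < s) (hM : 0 < M) (lam : Nat.Partition (d * m))
    (hℓ : lam.parts.card ≤ M ^ 2) (h₂ : secondPart lam ≤ s) (hsm : M ^ 2 * s ^ 2 ≤ m)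
    (hsd : M ^ 2 * s ≤ d)
    (v : MvPolynomial (DegIdx (MatIdx m) m) ℂ)
    (hv : v ∈ highestWeightSpace (coordRep (MatIdx m) ℂ m) (partitionWeightLex m lam))
    (hv0 : v ≠ 0) :
    v ∉ orbitVanishingIdeal f m := by
  classical
  have hm0 : m ≠ 0 := NeZero.ne m
  set iₘ := topMatIdx m with hiₘ'
  have hiₘ : ∀ i, i ≤ iₘ := le_topMatIdx m
  -- arithmetic
  have hM2 : 1 ≤ M ^ 2 := Nat.one_le_pow _ _ hM
  have hsm' : s ≤ m := by nlinarith
  have hlam : lam.parts.card ≤ m * m :=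
    hℓ.trans (((Nat.le_mul_of_pos_right (M ^ 2) (pow_pos hs 2)).trans hsm).trans (Nat.le_mul_self m))
  have hsd' : M ^ 2 * s ≤ d * s := hsd.trans (Nat.le_mul_of_pos_right d hs)
  have hb : secondPart lam + bodySize lam ≤ M ^ 2 * s := by
    have h1 := bodySize_le_card_sub_one_mul_secondPart lam
    have h3 : (lam.parts.card - 1) * secondPart lam + secondPart lam = lam.parts.card * secondPart lam := by
      rcases Nat.eq_zero_or_pos lam.parts.card with hc | hc
      · have : bodySize lam = 0 := bodySize_eq_zero_of_card_le_one lam (by omega)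
        have : secondPart lam = 0 := by
          have := secondPart_le_bodySize lam; omega
        simp [hc, this]
      · rw [← Nat.succ_pred_eq_of_pos hc, Nat.succ_sub_one, Nat.succ_mul]
    have h4 : lam.parts.card * secondPart lam ≤ M ^ 2 * s := Nat.mul_le_mul hℓ h₂
    omega
  have hb2 : secondPart lam + bodySize lam ≤ s * d := by
    calc secondPart lam + bodySize lam ≤ M ^ 2 * s := hb
      _ ≤ d * s := hsd'
      _ = s * d := mul_comm _ _
  have hk1 : 1 ≤ M ^ 2 * s := Nat.mul_pos (by omega) hs
  have hks : s * (M ^ 2 * s) ≤ m := by nlinarith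
  -- `v` is a form of degree `d`
  have hvd : v.IsHomogeneous d :=
    AlgebraicComplexity.isHomogeneous_of_mem_highestWeightSpace hm0 hv (size_partitionWeightLex lam hlam)
  -- inner lifting from `Sym^s` (Prop. 5.6(2))
  obtain ⟨mu, fv, hmuN, hmubody, hfd, hfw, hvf⟩ := bip2019_prop_5_6_2_holds m s m d hsm' lam hlam h₂ hb2 v hvd hv
  -- outer lifting from degree `k = M² s` (Prop. 5.8(2))
  have hkmu : secondPart mu + bodySize mu ≤ M ^ 2 * s := by
    rw [secondPart_add_bodySize_eq_of_erase_eq hmubody]; exact hb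
  obtain ⟨nu, g, -, -, hgd, hgw, hfg⟩ := bip2019_prop_5_8_2_holds m s d (M ^ 2 * s) mu hmuN hkmu hsd fv hfd hfw
  have hg0 : g ≠ 0 := by
    rintro rfl
    exact hv0 (by rw [hvf, hfg, mul_zero, map_zero])
  -- `g ∘ Δ` and `X_{x_{iₘ}^s} ∘ Δ`, with a common good power sum of `k` terms (Prop. 3.2)
  obtain ⟨G, hG⟩ : ∃ G : MvPolynomial (AlgebraicComplexity.DegIdx (Literature.NumberTheory.DiophantineGeometry.MatIdx m) s) ℂ,
      G = aeval (fun e : AlgebraicComplexity.DegIdx (Literature.NumberTheory.DiophantineGeometry.MatIdx m) s =>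
        C (((e.1 iₘ + (m - s)).descFactorial (m - s) : ℕ) : ℂ) * X e) g := ⟨_, rfl⟩
  have hsupp := AlgebraicComplexity.support_aeval_C_mul_X
    (fun e : AlgebraicComplexity.DegIdx (Literature.NumberTheory.DiophantineGeometry.MatIdx m) s => (((e.1 iₘ + (m - s)).descFactorial (m - s) : ℕ) : ℂ))
    (fun e => Nat.cast_ne_zero.mpr (AlgebraicComplexity.descFactorial_add_pos _ _).ne') g
  rw [← hG] at hsupp
  have hG0 : G ≠ 0 := by
    intro h0; apply hg0; rw [← support_eq_empty, ← hsupp, h0, support_zero]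
  have hGdeg : G.totalDegree ≤ M ^ 2 * s :=
    (totalDegree_le_of_support_subset hsupp.le).trans (hgd.totalDegree hg0).le
  have hXdeg : (X (topDegIdx m s) : MvPolynomial (AlgebraicComplexity.DegIdx (Literature.NumberTheory.DiophantineGeometry.MatIdx m) s) ℂ).totalDegree
      ≤ M ^ 2 * s := by rw [totalDegree_X]; exact hk1
  obtain ⟨φ, hφG, hφX⟩ := AlgebraicComplexity.exists_aeval_formCoeff_sum_linearFormPow_ne_zero_and hs G
    (X (topDegIdx m s)) hG0 (X_ne_zero _) hGdeg hXdeg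
  rw [aeval_X] at hφX
  obtain ⟨p, hp⟩ : ∃ p : MvPolynomial (Literature.NumberTheory.DiophantineGeometry.MatIdx m) ℂ,
      p = ∑ i, (∑ x, C (φ i x) * X x) ^ s := ⟨_, rfl⟩
  rw [← hp] at hφG hφX
  have hphom : p.IsHomogeneous s := by rw [hp]; exact Complexity.isHomogeneous_sum_linearFormPow φ s
  obtain ⟨q, hq⟩ : ∃ q : MvPolynomial (Literature.NumberTheory.DiophantineGeometry.MatIdx m) ℂ, q = X iₘ ^ (m - s) * p := ⟨_, rfl⟩
  have hqhom : q.IsHomogeneous m := by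
    have := (isHomogeneous_X_pow (R := ℂ) iₘ (m - s)).mul hphom
    rwa [Nat.sub_add_cancel hsm', ← hq] at this
  have hqmem : q ∈ orbitClosure f := by
    rw [hq, hp]
    exact hps s (M ^ 2 * s) hks φ
  -- `v(q) = fv(Δ p) = (X_{x^s}(Δ p))^{d-k} · g(Δ p) ≠ 0`
  have hvq : aeval (AlgebraicComplexity.formCoeff m q) v ≠ 0 := by
    rw [hvf, AlgebraicComplexity.aeval_formCoeff_innerLift iₘ hqhom, hq,
      AlgebraicComplexity.aeval_formCoeff_iterPderiv_X_pow_mul iₘ (m - s) hphom, hfg, map_mul, map_pow,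
      map_mul, map_pow, ← hG]
    refine mul_ne_zero (pow_ne_zero _ ?_) hφG
    rw [aeval_X, map_mul, aeval_C, aeval_X, Algebra.algebraMap_self_apply]
    exact mul_ne_zero (Nat.cast_ne_zero.mpr (AlgebraicComplexity.descFactorial_add_pos _ _).ne') hφX
  intro hvI
  exact hvq (aeval_formCoeff_eq_zero_of_mem_orbitClosure_of_mem hf hf0 hqmem hvI)

/-- **BIP Prop. 2.3 (row-extended even rectangles occur) for a target containing the padded power
sums.** "Let `n ≥ kℓ` and `ℓ` be even. Then `(k × ℓ)♯nk` occurs in `ℂ[Ω_n]_k`" — with `Ω_n`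
replaced by any `Δ[f] ⊇` padded power sums (§2(d)); rendering of `Complexity.bip2019_prop_2_3`,
proof of `Complexity.bip2019_prop_2_3_holds` (Cayley's hyperdeterminant as the highest weight
vector of Cor. 4.8, lifted, evaluated at `X_{iₘ}^{m-ℓ}(x_{t_1}^ℓ + ⋯ + x_{t_k}^ℓ)`).
[cite: BurgisserIkenmeyerPanovaJAMS2019, Prop. 2.3, §6(b) and §2(d)] -/
theorem hasHighestWeight_orbitCoordRep_rowExtendedRectangle_of_paddedPowerSums
    (hf : f.IsHomogeneous m) (hf0 : f ≠ 0)
    (hps : ∀ (s r : ℕ), s * r ≤ m → ∀ φ : Fin r → MatIdx m → ℂ,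
      (X (topMatIdx m) ^ (m - s) * ∑ i, (∑ x, C (φ i x) * X x : MvPolynomial (MatIdx m) ℂ) ^ s) ∈
        orbitClosure f)
    {kk ℓ : ℕ} (hk : 0 < kk) (hℓ : 0 < ℓ) (he : Even ℓ) (hkℓ : kk * ℓ ≤ m) :
    HasHighestWeight (orbitCoordRep f m) (partitionWeightLex m (rowExtendedRectangle kk ℓ (kk * m))) := by
  classical
  have hkN : kk ≤ m * m := le_trans (le_trans (Nat.le_mul_of_pos_right kk hℓ) hkℓ) (Nat.le_mul_self m)
  have hℓm : ℓ ≤ m := le_trans (Nat.le_mul_of_pos_left ℓ hk) hkℓ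
  set t := topLetters m kk hkN with ht
  set iₘ := topMatIdx m with hiₘ'
  have hiₘ : ∀ i, i ≤ iₘ := le_topMatIdx m
  -- the lifted hyperdeterminant and its weight
  set F : MvPolynomial (AlgebraicComplexity.DegIdx (Literature.NumberTheory.DiophantineGeometry.MatIdx m) ℓ) ℂ := AlgebraicComplexity.hyperdetPoly ℓ t with hF
  have hFw := AlgebraicComplexity.hyperdetPoly_mem_highestWeightSpace (k := ℂ) (ℓ := ℓ) (topLetters_strictMono m kk hkN)
    (topLetters_upper m kk hkN)
  have hFd := AlgebraicComplexity.isHomogeneous_hyperdetPoly (k := ℂ) (ℓ := ℓ) t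
  have hhw := AlgebraicComplexity.innerLift_mem_highestWeightSpace iₘ hiₘ hℓm hFd hFw
  rw [rectWeight_add_single_eq m kk ℓ hk hℓm hkN] at hhw
  refine Complexity.hasHighestWeight_orbitCoordRep_of_not_mem _ m hhw ?_
  -- the padded power sum of the letters lies in `Δ[f]` (hypothesis `hps`)
  set p : MvPolynomial (Literature.NumberTheory.DiophantineGeometry.MatIdx m) ℂ := ∑ a, X (t a) ^ ℓ with hp
  have hpsum : p = ∑ a, (∑ x, C (if x = t a then (1 : ℂ) else 0) * X x) ^ ℓ := by
    rw [hp]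
    refine Finset.sum_congr rfl fun a _ => ?_
    congr 1
    rw [Finset.sum_eq_single (t a)]
    · simp
    · intro x _ hx; simp [hx]
    · exact fun h => absurd (Finset.mem_univ _) h
  have hphom : p.IsHomogeneous ℓ := IsHomogeneous.sum _ _ _ fun a _ => isHomogeneous_X_pow _ _
  obtain ⟨q, hq⟩ : ∃ q : MvPolynomial (Literature.NumberTheory.DiophantineGeometry.MatIdx m) ℂ, q = X iₘ ^ (m - ℓ) * p := ⟨_, rfl⟩
  have hqhom : q.IsHomogeneous m := by
    have := (isHomogeneous_X_pow (R := ℂ) iₘ (m - ℓ)).mul hphom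
    rwa [Nat.sub_add_cancel hℓm, ← hq] at this
  have hqmem : q ∈ orbitClosure f := by
    have hsr : ℓ * kk ≤ m := by rw [mul_comm]; exact hkℓ
    rw [hq, hpsum]
    exact hps ℓ kk hsr _
  -- the lifted hyperdeterminant does not vanish there
  have hval : aeval (AlgebraicComplexity.formCoeff m q) (AlgebraicComplexity.innerLift iₘ ℓ m F) ≠ 0 := by
    rw [AlgebraicComplexity.aeval_formCoeff_innerLift iₘ hqhom, hq]
    have hpt : AlgebraicComplexity.formCoeff ℓ (AlgebraicComplexity.iterPderiv iₘ (m - ℓ) (X iₘ ^ (m - ℓ) * p)) =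
        fun e : AlgebraicComplexity.DegIdx (Literature.NumberTheory.DiophantineGeometry.MatIdx m) ℓ =>
          (((e.1 iₘ + (m - ℓ)).descFactorial (m - ℓ) : ℕ) : ℂ) * AlgebraicComplexity.formCoeff ℓ p e :=
      funext fun e => AlgebraicComplexity.formCoeff_iterPderiv_X_pow_mul iₘ (m - ℓ) hphom e
    rw [hpt, hp, hF, AlgebraicComplexity.aeval_hyperdetPoly_scaled_powerSum (topLetters_strictMono m kk hkN).injective hℓ he]
    refine mul_ne_zero (Nat.cast_ne_zero.mpr (Nat.factorial_ne_zero kk)) ?_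
    exact Finset.prod_ne_zero_iff.mpr fun a _ => Nat.cast_ne_zero.mpr (AlgebraicComplexity.descFactorial_add_pos _ _).ne'
  intro hI
  exact hval (aeval_formCoeff_eq_zero_of_mem_orbitClosure_of_mem hf hf0 hqmem hI)

/-- **BIP Thm. 6.2 (the hook-like building blocks occur) for a target containing the padded power
sums.** "Let `2 ≤ b, c ≤ m²` and let `n ≥ 24m⁶`. Then there exists an even `i ≤ 2m⁴`, such that
`λ = b × 1 + c × i + 1 × j` occurs in `ℂ[Ω_n]_{3m⁴}` for `j = 3m⁴n − b − ic`" — with `Ω_n` replaced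
by any `Δ[f] ⊇` padded power sums (§2(d)); rendering of `Complexity.bip2019_thm_6_2` (target `m`,
parameter `M`), proof of `Complexity.bip2019_thm_6_2_holds` (the explicit tableau of §7,
`Complexity.exists_hwv_hookPartition`, lifted and evaluated at a padded power sum with
`8M² · 3M⁴ = 24M⁶ ≤ m`). [cite: BurgisserIkenmeyerPanovaJAMS2019, Thm. 6.2, §7 and §2(d)] -/
theorem exists_hasHighestWeight_orbitCoordRep_hookPartition_of_paddedPowerSums
    (hf : f.IsHomogeneous m) (hf0 : f ≠ 0)
    (hps : ∀ (s r : ℕ), s * r ≤ m → ∀ φ : Fin r → MatIdx m → ℂ,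
      (X (topMatIdx m) ^ (m - s) * ∑ i, (∑ x, C (φ i x) * X x : MvPolynomial (MatIdx m) ℂ) ^ s) ∈
        orbitClosure f)
    {M b c : ℕ} (hb : 2 ≤ b) (hbM : b ≤ M ^ 2) (hc : 2 ≤ c) (hcM : c ≤ M ^ 2)
    (hm : 24 * M ^ 6 ≤ m) :
    ∃ i, Even i ∧ i ≤ 2 * M ^ 4 ∧
      HasHighestWeight (orbitCoordRep f m) (partitionWeightLex m (hookPartition b c i (3 * M ^ 4 * m))) := by
  classical
  have hm0 : m ≠ 0 := NeZero.ne m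
  set iₘ := topMatIdx m with hiₘ'
  have hiₘ : ∀ i, i ≤ iₘ := le_topMatIdx m
  -- parameters `r = b - 1`, `t = c - 1`
  obtain ⟨r, rfl⟩ : ∃ r, b = r + 1 := ⟨b - 1, by omega⟩
  obtain ⟨t, rfl⟩ : ∃ t, c = t + 1 := ⟨c - 1, by omega⟩
  have hr : 0 < r := by omega
  have ht : 0 < t := by omega
  have hM2 : 2 ≤ M := by
    by_contra hM
    have hM1 : M ≤ 1 := by omega
    have : M ^ 2 ≤ 1 ^ 2 := Nat.pow_le_pow_left hM1 2
    omega
  set E := (r - 1) / (2 * t) + 1 with hE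
  obtain ⟨hrK, hI2, hd, hn'⟩ := hook_params hM2 hr hbM ht hcM
  set i := hookI t E with hi
  have hieven : Even i := ⟨E * (2 * E * t + 1), by rw [hi]; unfold hookI; ring⟩
  refine ⟨i, hieven, hI2, ?_⟩
  -- positivity with `V = ℂ^{m×m}`, inner degree `8M²`, degree `3M⁴`
  have hMpos : 0 < M := by omega
  have hN : max r t + 1 ≤ m * m := by
    have h1 : max r t + 1 ≤ M ^ 2 := by omega
    have h2 : M ^ 2 ≤ 24 * M ^ 6 := by
      calc M ^ 2 ≤ M ^ 6 := Nat.pow_le_pow_right hMpos (by norm_num)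
        _ ≤ 24 * M ^ 6 := Nat.le_mul_of_pos_left _ (by norm_num)
    exact h1.trans (h2.trans (hm.trans (Nat.le_mul_self m)))
  obtain ⟨fv, hfv0, hfd, hfw⟩ := exists_hwv_hookPartition (n := 8 * M ^ 2) (d := 3 * M ^ 4) m ht hr hrK hd hn' hN
  -- lift from inner degree `8M²` to `m` (BIP §7, last paragraph; as in §6(a))
  have hprod : 8 * M ^ 2 * (3 * M ^ 4) = 24 * M ^ 6 := by ring
  have hn'dm : 8 * M ^ 2 * (3 * M ^ 4) ≤ m := hprod ▸ hm
  have hdpos : 0 < 3 * M ^ 4 := by positivity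
  have hn'pos : 0 < 8 * M ^ 2 := by positivity
  have hn'm : 8 * M ^ 2 ≤ m := le_trans (Nat.le_mul_of_pos_right _ hdpos) hn'dm
  have hlift := AlgebraicComplexity.innerLift_mem_highestWeightSpace iₘ hiₘ hn'm hfd hfw
  have hbc : r + 1 + (t + 1) * i ≤ 3 * M ^ 4 * (8 * M ^ 2) :=
    hookShape_le (E := E) ht hrK hd hn'
  have hDD : 3 * M ^ 4 * (8 * M ^ 2) ≤ 3 * M ^ 4 * m := Nat.mul_le_mul_left _ hn'm
  have hw := partitionWeightLex_hookPartition_add_single m (Nat.succ_pos r) (Nat.succ_pos t) hbc hDD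
  have hsub : 3 * M ^ 4 * m - 3 * M ^ 4 * (8 * M ^ 2) = (m - 8 * M ^ 2) * (3 * M ^ 4) := by
    rw [Nat.sub_mul, Nat.mul_comm m, Nat.mul_comm (8 * M ^ 2)]
  rw [hsub] at hw
  rw [hw] at hlift
  refine Complexity.hasHighestWeight_orbitCoordRep_of_not_mem f m hlift ?_
  -- nonvanishing on `Δ[f]`: evaluate the lifted vector at a padded power sum (hypothesis `hps`)
  obtain ⟨F, hF⟩ : ∃ F : MvPolynomial (AlgebraicComplexity.DegIdx (Literature.NumberTheory.DiophantineGeometry.MatIdx m) (8 * M ^ 2)) ℂ,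
      F = aeval (fun e : AlgebraicComplexity.DegIdx (Literature.NumberTheory.DiophantineGeometry.MatIdx m) (8 * M ^ 2) =>
        C (((e.1 iₘ + (m - 8 * M ^ 2)).descFactorial (m - 8 * M ^ 2) : ℕ) : ℂ) * X e) fv := ⟨_, rfl⟩
  have hsupp := AlgebraicComplexity.support_aeval_C_mul_X
    (fun e : AlgebraicComplexity.DegIdx (Literature.NumberTheory.DiophantineGeometry.MatIdx m) (8 * M ^ 2) =>
      (((e.1 iₘ + (m - 8 * M ^ 2)).descFactorial (m - 8 * M ^ 2) : ℕ) : ℂ))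
    (fun e => Nat.cast_ne_zero.mpr (AlgebraicComplexity.descFactorial_add_pos _ _).ne') fv
  rw [← hF] at hsupp
  have hF0 : F ≠ 0 := by
    intro h0
    apply hfv0
    rw [← support_eq_empty, ← hsupp, h0, support_zero]
  have hFdeg : F.totalDegree ≤ 3 * M ^ 4 :=
    (totalDegree_le_of_support_subset hsupp.le).trans (hfd.totalDegree hfv0).le
  obtain ⟨φ, hφ⟩ := AlgebraicComplexity.exists_aeval_formCoeff_sum_linearFormPow_ne_zero hn'pos F hF0 hFdeg
  obtain ⟨p, hp⟩ : ∃ p : MvPolynomial (Literature.NumberTheory.DiophantineGeometry.MatIdx m) ℂ,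
      p = ∑ j, (∑ x, C (φ j x) * X x) ^ (8 * M ^ 2) := ⟨_, rfl⟩
  have hphom : p.IsHomogeneous (8 * M ^ 2) := by
    rw [hp]
    exact Complexity.isHomogeneous_sum_linearFormPow φ (8 * M ^ 2)
  obtain ⟨q, hq⟩ : ∃ q : MvPolynomial (Literature.NumberTheory.DiophantineGeometry.MatIdx m) ℂ, q = X iₘ ^ (m - 8 * M ^ 2) * p :=
    ⟨_, rfl⟩
  have hqhom : q.IsHomogeneous m := by
    have := (isHomogeneous_X_pow (R := ℂ) iₘ (m - 8 * M ^ 2)).mul hphom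
    rwa [Nat.sub_add_cancel hn'm, ← hq] at this
  have hqmem : q ∈ orbitClosure f := by
    rw [hq, hp]
    exact hps (8 * M ^ 2) (3 * M ^ 4) hn'dm φ
  have hvq : aeval (AlgebraicComplexity.formCoeff m q) (AlgebraicComplexity.innerLift iₘ (8 * M ^ 2) m fv) ≠ 0 := by
    rw [AlgebraicComplexity.aeval_formCoeff_innerLift iₘ hqhom, hq,
      AlgebraicComplexity.aeval_formCoeff_iterPderiv_X_pow_mul iₘ (m - 8 * M ^ 2) hphom, ← hF, hp]
    exact hφ
  intro hvI
  exact hvq (aeval_formCoeff_eq_zero_of_mem_orbitClosure_of_mem hf hf0 hqmem hvI)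

/-- **`(m)` occurs in `ℂ[Δ[f]]_1`, in `♯`-coordinates** (BIP §6(a)): the weight
`sharpAddHom m (m²) (0, 1) = (m, 0, …, 0)` occurs, i.e. its dual `-m ε_{iₘ}` does
(`hasHighestWeight_orbitCoordRep_single_top_of_paddedPowerSums`); generic form of
`Complexity.sharpAddHom_zero_one_mem_detOccWeights`, same computation of the dual weight.
[cite: BurgisserIkenmeyerPanovaJAMS2019, §6(a)] -/
theorem hasHighestWeight_orbitCoordRep_sharp_zero_one_of_paddedPowerSums
    (hf : f.IsHomogeneous m) (hf0 : f ≠ 0)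
    (hps : ∀ (s r : ℕ), s * r ≤ m → ∀ φ : Fin r → MatIdx m → ℂ,
      (X (topMatIdx m) ^ (m - s) * ∑ i, (∑ x, C (φ i x) * X x : MvPolynomial (MatIdx m) ℂ) ^ s) ∈
        orbitClosure f) :
    HasHighestWeight (orbitCoordRep f m) (Weight.dual (sharpAddHom m (m * m) (0, 1))).toMatIdx := by
  have hN : 0 < m * m := Nat.mul_pos (NeZero.pos m) (NeZero.pos m)
  set i₀ : Fin (m * m) := ⟨0, hN⟩ with hi₀
  set iₘ : Literature.NumberTheory.DiophantineGeometry.MatIdx m := Literature.NumberTheory.DiophantineGeometry.matIdxEquiv m (Fin.rev i₀) with hiₘ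
  have htop : ∀ i, i ≤ iₘ := fun i => by
    rw [hiₘ, ← (Literature.NumberTheory.DiophantineGeometry.matIdxEquiv m).apply_symm_apply i, (Literature.NumberTheory.DiophantineGeometry.matIdxEquiv m).le_iff_le,
      Fin.le_rev_iff]
    exact Fin.mk_le_mk.mpr (Nat.zero_le _)
  
  have h : (Literature.NumberTheory.DiophantineGeometry.Weight.dual (sharpAddHom m (m * m) (0, 1))).toMatIdx =
      Pi.single iₘ (-(m : ℤ)) := by
    funext ij
    simp only [Literature.NumberTheory.DiophantineGeometry.Weight.toMatIdx, Literature.NumberTheory.DiophantineGeometry.Weight.dual, sharpAddHom_apply,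
      Pi.zero_apply, Finset.sum_const_zero, sub_zero, zero_add, Nat.cast_one, one_mul]
    have hiff : ((Fin.rev ((Literature.NumberTheory.DiophantineGeometry.matIdxEquiv m).symm ij) : Fin (m * m)) : ℕ) = 0 ↔
        ij = iₘ := by
      constructor
      · intro h0
        have h1 : Fin.rev ((Literature.NumberTheory.DiophantineGeometry.matIdxEquiv m).symm ij) = i₀ := Fin.ext h0
        rw [hiₘ, ← h1, Fin.rev_rev, OrderIso.apply_symm_apply]
      · intro hij
        rw [hij, hiₘ, OrderIso.symm_apply_apply, Fin.rev_rev]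
    by_cases hij : ij = iₘ
    · rw [if_pos (hiff.mpr hij), hij, Pi.single_eq_same]
    · rw [if_neg (fun h => hij (hiff.mp h)), Pi.single_eq_of_ne hij, neg_zero]
  rw [h]
  exact hasHighestWeight_orbitCoordRep_single_top_of_paddedPowerSums hf hf0 iₘ htop
    (by rwa [show iₘ = topMatIdx m from le_antisymm (le_topMatIdx m _) (htop _)])

/-- **BIP Prop. 6.3 (splitting into building blocks) for a target containing the padded power
sums.** "Given a partition `λ` with `|λ| = nd` such that there exists `m ≥ 2` with `ℓ(λ) ≤ m²`,
`m^{10} ≤ |λ̄| ≤ m d`, `n ≥ 24 m^6`, and `d > 4 m^6`. Then `λ` occurs in `ℂ[Ω_n]_d`" — with `Ω_n`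
replaced by any `Δ[f] ⊇` padded power sums (§2(d)); rendering of `Complexity.bip2019_prop_6_3`,
proof of `Complexity.bip2019_prop_6_3_of_parts`: the splitting technique
`Complexity.mem_of_splitting` run in the additive monoid of occurring weights of `ℂ[Δ[f]]`
(semigroup property Lemma 2.2 = `HasHighestWeight.add_of_orbitCoordRep`, any orbit closure), fed
with `(m)` (§6(a)), the even rectangles (Prop. 2.3) and the hook blocks (Thm. 6.2) of this section.
[cite: BurgisserIkenmeyerPanovaJAMS2019, Prop. 6.3 and §2(d)] -/
theorem hasHighestWeight_orbitCoordRep_of_large_body_of_paddedPowerSums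
    (hf : f.IsHomogeneous m) (hf0 : f ≠ 0)
    (hps : ∀ (s r : ℕ), s * r ≤ m → ∀ φ : Fin r → MatIdx m → ℂ,
      (X (topMatIdx m) ^ (m - s) * ∑ i, (∑ x, C (φ i x) * X x : MvPolynomial (MatIdx m) ℂ) ^ s) ∈
        orbitClosure f)
    {d M : ℕ} (hM : 2 ≤ M) (lam : Nat.Partition (d * m))
    (hℓ : lam.parts.card ≤ M ^ 2) (hb₁ : M ^ 10 ≤ bodySize lam) (hb₂ : bodySize lam ≤ M * d)
    (hm : 24 * M ^ 6 ≤ m) (hd : 4 * M ^ 6 < d) :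
    HasHighestWeight (orbitCoordRep f m) (partitionWeightLex m lam) := by
  classical
  -- numerics
  have hMpos : 0 < M := by omega
  have hM2m : M ^ 2 ≤ m := by
    calc M ^ 2 ≤ M ^ 6 := Nat.pow_le_pow_right hMpos (by norm_num)
      _ ≤ 24 * M ^ 6 := Nat.le_mul_of_pos_left _ (by norm_num)
      _ ≤ m := hm
  have hmN : m ≤ m * m := Nat.le_mul_self m
  set N := m * m with hN
  -- the additive monoid of occurring weights of `ℂ[Δ[f]]`, in `Fin (m²)`-coordinates of partitions
  let S : AddSubmonoid (Weight (Fin (m * m))) :=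
    { carrier := {χ | HasHighestWeight (orbitCoordRep f m) (Weight.dual χ).toMatIdx}
      add_mem' := fun {χ ψ} hχ hψ => by
        have h : (Weight.dual (χ + ψ)).toMatIdx = (Weight.dual χ).toMatIdx + (Weight.dual ψ).toMatIdx := by
          funext ij
          simp [Weight.toMatIdx, Weight.dual, add_comm]
        simp only [Set.mem_setOf_eq] at hχ hψ ⊢
        rw [h]
        exact HasHighestWeight.add_of_orbitCoordRep _ m hχ hψ
      zero_mem' := by
        have h : (Weight.dual (0 : Weight (Fin (m * m)))).toMatIdx = 0 := by
          funext ij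
          simp [Weight.toMatIdx, Weight.dual]
        simp only [Set.mem_setOf_eq]
        rw [h]
        exact Complexity.hasHighestWeight_orbitCoordRep_zero _ m }
  have hS : ∀ {D : ℕ} (mu : Nat.Partition D), Weight.ofPartition (m * m) mu ∈ S ↔
      HasHighestWeight (orbitCoordRep f m) (partitionWeightLex m mu) := fun _ => Iff.rfl
  have hS0 : ∀ χ, χ ∈ S ↔ HasHighestWeight (orbitCoordRep f m) (Weight.dual χ).toMatIdx :=
    fun _ => Iff.rfl
  -- rows `W r = λ_{r+1}`, number of rows `L`, column counts `c k`
  set W : ℕ → ℕ := fun r => lam.sortedParts.getD r 0 with hW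
  set L := lam.parts.card with hL
  have hWanti : Antitone W := antitone_getD_sortedParts lam
  have hWL : ∀ r, L ≤ r → W r = 0 := fun r hr =>
    List.getD_eq_default _ _ (by rwa [Nat.Partition.length_sortedParts])
  have hsumW : ∑ r ∈ range L, W r = d * m := sum_range_getD_sortedParts lam
  have hsup : lam.parts.sup = W 0 := sup_parts_eq_getD_sortedParts lam
  have hLM : L ≤ M ^ 2 := hℓ
  have hLN : L ≤ N := hLM.trans (hM2m.trans hmN)
  -- `L ≥ 1` (else `|λ̄| = 0`)
  have hL1 : 1 ≤ L := by
    by_contra h0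
    have hb0 : bodySize lam = 0 := bodySize_eq_zero_of_card_le_one lam (by omega)
    rw [hb0] at hb₁
    exact absurd hb₁ (not_le.mpr (pow_pos hMpos 10))
  -- `|λ̄| = ∑_{1 ≤ r < L} W r`
  have hbody : bodySize lam = ∑ r ∈ Ico 1 L, W r := by
    unfold bodySize
    rw [hsup, ← hsumW, Finset.range_eq_Ico, Finset.sum_eq_sum_Ico_succ_bot hL1, zero_add,
      Nat.add_sub_cancel_left]
  set c : ℕ → ℕ := fun k => W (k - 1) - W k with hc
  have hkc : ∑ k ∈ Ioc 1 L, k * c k = W 1 + bodySize lam := by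
    have h := sum_Ioc_mul_sub_eq hWanti hL1
    rw [hWL L le_rfl, Nat.mul_zero, Nat.add_zero] at h
    rw [hbody]
    exact h
  have hc₁ : ∑ k ∈ Ioc 1 L, (k - 1) * c k = bodySize lam := by
    have h1 : ∑ k ∈ Ioc 1 L, (k - 1) * c k + ∑ k ∈ Ioc 1 L, c k = ∑ k ∈ Ioc 1 L, k * c k := by
      rw [← Finset.sum_add_distrib]
      refine Finset.sum_congr rfl fun k hk => ?_
      rw [mem_Ioc] at hk
      obtain ⟨k', rfl⟩ := Nat.exists_eq_add_of_le' (show 1 ≤ k by omega)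
      rw [Nat.add_sub_cancel]
      ring
    have h2 : ∑ k ∈ Ioc 1 L, c k = W 1 := by
      have h := sum_Ioc_sub_eq hWanti hL1
      rw [hWL L le_rfl, Nat.sub_zero] at h
      exact h
    omega
  have hW1 : W 1 ≤ bodySize lam := by
    rw [hbody]
    by_cases h2 : 2 ≤ L
    · exact Finset.single_le_sum (f := W) (fun _ _ => Nat.zero_le _) (by rw [mem_Ico]; omega)
    · rw [hWL 1 (by omega)]
      exact Nat.zero_le _
  have hc₂ : ∑ k ∈ Ioc 1 L, k * c k ≤ 2 * M * d := by
    rw [hkc]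
    calc W 1 + bodySize lam ≤ bodySize lam + bodySize lam := by omega
      _ ≤ M * d + M * d := Nat.add_le_add hb₂ hb₂
      _ = 2 * M * d := by ring
  -- the weight of `λ` is the `♯`-lift of its body `∑ c_k • colBody k` in degree `d`
  have hof : Literature.NumberTheory.DiophantineGeometry.Weight.ofPartition N lam =
      sharpAddHom m N (∑ k ∈ Ioc 1 L, c k • colBody N k, d) := by
    rw [← body_eq_sum_colBody hWanti hWL]
    have hsumN : ∑ r ∈ range N, (W r : ℤ) = d * m := by
      rw [← Finset.sum_subset (Finset.range_subset_range.mpr hLN) fun r _ hr => by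
        rw [hWL r (by simpa using hr), Nat.cast_zero]]
      exact_mod_cast hsumW
    have hNpos : 0 < N := by rw [hN]; exact Nat.mul_pos (NeZero.pos m) (NeZero.pos m)
    have hsumβ : ∑ i : Fin N, (if ((i : Fin N) : ℕ) = 0 then (0 : ℤ) else (W i : ℤ)) =
        d * m - W 0 := by
      rw [Fin.sum_univ_eq_sum_range (fun n => if n = 0 then (0 : ℤ) else (W n : ℤ)) N,
        Finset.range_eq_Ico, Finset.sum_eq_sum_Ico_succ_bot hNpos, if_pos rfl, zero_add]
      rw [Finset.range_eq_Ico, Finset.sum_eq_sum_Ico_succ_bot hNpos] at hsumN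
      rw [Finset.sum_congr rfl fun r hr => if_neg (by rw [mem_Ico] at hr; omega)]
      linarith
    funext r
    rw [sharpAddHom_apply, Literature.NumberTheory.DiophantineGeometry.Weight.ofPartition_apply, hsumβ]
    by_cases hr : (r : ℕ) = 0
    · simp only [hr, if_true, hW]
      ring
    · simp only [hr, if_false, add_zero]
      rfl
  -- run the splitting technique in the monoid of occurring weights
  rw [← hS lam, hof]
  have key := mem_of_splitting (S.comap (sharpAddHom m N)) (colBody N) c hM hLM
    hm hd (hc₁ ▸ hb₁) hc₂ ?_ ?_ ?_
  · exact AddSubmonoid.mem_comap.mp key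
  · -- `(m)` occurs
    exact AddSubmonoid.mem_comap.mpr
      ((hS0 _).mpr (hasHighestWeight_orbitCoordRep_sharp_zero_one_of_paddedPowerSums hf hf0 hps))
  · -- Prop. 2.3
    intro k hk ℓ hℓ0 hℓe hkℓ
    rw [mem_Ioc] at hk
    have hk0 : 0 < k := by omega
    have hℓm : ℓ ≤ m := le_trans (Nat.le_mul_of_pos_left ℓ hk0) hkℓ
    rw [AddSubmonoid.mem_comap, ← ofPartition_rowExtendedRectangle hk0 hℓm (by omega),
      hS]
    exact hasHighestWeight_orbitCoordRep_rowExtendedRectangle_of_paddedPowerSums hf hf0 hps hk0 hℓ0 hℓe hkℓ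
  · -- Thm. 6.2
    intro b hb c' hc'
    rw [mem_Ioc] at hb hc'
    obtain ⟨i, hie, hile, hocc⟩ :=
      exists_hasHighestWeight_orbitCoordRep_hookPartition_of_paddedPowerSums hf hf0 hps (M := M)
        (b := b) (c := c') (by omega) (by omega) (by omega) (by omega) hm
    refine ⟨i, hie, hile, ?_⟩
    have hbci : b + c' * i ≤ 3 * M ^ 4 * m := by
      have h1 : b ≤ M ^ 4 * m := by
        calc b ≤ M ^ 2 := by omega
          _ ≤ M ^ 4 := Nat.pow_le_pow_right hMpos (by norm_num)
          _ ≤ M ^ 4 * m := Nat.le_mul_of_pos_right _ (NeZero.pos m)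
      have h2 : c' * i ≤ 2 * (M ^ 4 * m) := by
        calc c' * i ≤ M ^ 2 * (2 * M ^ 4) := Nat.mul_le_mul (by omega) hile
          _ = 2 * (M ^ 4 * M ^ 2) := by ring
          _ ≤ 2 * (M ^ 4 * m) := Nat.mul_le_mul_left 2 (Nat.mul_le_mul_left _ hM2m)
      rw [mul_assoc]
      omega
    rw [AddSubmonoid.mem_comap, ← ofPartition_hookPartition (M := M) (by omega) (by omega)
      (by omega) (by omega) hbci, hS]
    exact hocc

/-- **The padding-free core of BIP's "Proof of Theorem 1.4" for a target containing the padded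
power sums** (end of §6, arXiv v3 p. 22; generic form of
`Complexity.hasHighestWeight_detOrbitRep_of_parts`, same case analysis): let `M ≥ 1`, `M^25 ≤ m`,
and let `λ ⊢ d·m` satisfy `ℓ(λ) ≤ M²` and `|λ̄| ≤ M d` and occur in `Sym^d Sym^m V`; then `λ`
occurs in `ℂ[Δ[f]]_d`. Cases `d = 0`; `M d² ≤ m` (Prop. 2.4); else `d > M^{12}` and
`|λ̄| < M^{10}` (Prop. 6.1 with `s = M^{10}`) or `|λ̄| ≥ M^{10}` (Prop. 6.3).
[cite: BurgisserIkenmeyerPanovaJAMS2019, §6 (Proof of Theorem 1.4) and §2(d)] -/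
theorem hasHighestWeight_orbitCoordRep_of_parts_of_paddedPowerSums (hf : f.IsHomogeneous m)
    (hf0 : f ≠ 0)
    (hps : ∀ (s r : ℕ), s * r ≤ m → ∀ φ : Fin r → MatIdx m → ℂ,
      (X (topMatIdx m) ^ (m - s) * ∑ i, (∑ x, C (φ i x) * X x : MvPolynomial (MatIdx m) ℂ) ^ s) ∈
        orbitClosure f)
    {d M : ℕ} (hM : 0 < M) (hMm : M ^ 25 ≤ m)
    (lam : Nat.Partition (d * m)) (hℓ : lam.parts.card ≤ M ^ 2) (hbody : bodySize lam ≤ M * d)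
    (hocc : HasHighestWeight (coordRep (MatIdx m) ℂ m) (partitionWeightLex m lam)) :
    HasHighestWeight (orbitCoordRep f m) (partitionWeightLex m lam) := by
  have hM1 : 1 ≤ M := hM
  have hM2m : M ^ 2 ≤ m :=
    (Nat.pow_le_pow_right hM (by norm_num : 2 ≤ 25)).trans hMm
  have hlam : lam.parts.card ≤ m * m := hℓ.trans (hM2m.trans (Nat.le_mul_self m))
  -- degree 0: the trivial weight
  rcases Nat.eq_zero_or_pos d with rfl | hd
  · rw [partitionWeightLex_eq_zero m lam (Nat.zero_mul m)]
    exact Complexity.hasHighestWeight_orbitCoordRep_zero _ m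
  -- small degree: Prop. 2.4
  by_cases hA : M * d ^ 2 ≤ m
  · exact Complexity.hasHighestWeight_orbitCoordRep_of_forall_not_mem f m hocc fun v hv hv0 =>
      not_mem_orbitVanishingIdeal_of_small_degree_of_paddedPowerSums hf hf0 hps hd hM lam hlam hbody
        hA v hv hv0
  -- large degree: `M ^ 12 < d`
  have hd12 : M ^ 12 < d := by
    have h1 : M * M ^ 24 < M * d ^ 2 := by
      calc M * M ^ 24 = M ^ 25 := by ring
        _ ≤ m := hMm
        _ < M * d ^ 2 := Nat.lt_of_not_le hA
    have h2 : (M ^ 12) ^ 2 < d ^ 2 := by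
      have := Nat.lt_of_mul_lt_mul_left h1
      calc (M ^ 12) ^ 2 = M ^ 24 := by ring
        _ < d ^ 2 := this
    exact lt_of_pow_lt_pow_left₀ 2 (Nat.zero_le d) h2
  by_cases hB : bodySize lam < M ^ 10
  · -- extremely long first row: Prop. 6.1 with `s = M ^ 10`
    have hs : 0 < M ^ 10 := pow_pos hM 10
    have h₂ : secondPart lam ≤ M ^ 10 := (secondPart_le_bodySize lam).trans hB.le
    have hsm : M ^ 2 * (M ^ 10) ^ 2 ≤ m := by
      calc M ^ 2 * (M ^ 10) ^ 2 = M ^ 22 := by ring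
        _ ≤ M ^ 25 := Nat.pow_le_pow_right hM (by norm_num)
        _ ≤ m := hMm
    have hsd : M ^ 2 * M ^ 10 ≤ d := by
      calc M ^ 2 * M ^ 10 = M ^ 12 := by ring
        _ ≤ d := hd12.le
    exact Complexity.hasHighestWeight_orbitCoordRep_of_forall_not_mem f m hocc fun v hv hv0 =>
      not_mem_orbitVanishingIdeal_of_long_first_row_of_paddedPowerSums hf hf0 hps hs hM lam hℓ h₂
        hsm hsd v hv hv0
  · -- large body: Prop. 6.3
    have hB' : M ^ 10 ≤ bodySize lam := Nat.le_of_not_lt hB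
    have hM2 : 2 ≤ M := by
      by_contra hlt
      have hM1' : M = 1 := by omega
      subst hM1'
      have hcard : lam.parts.card ≤ 1 := by simpa using hℓ
      have h0 := bodySize_eq_zero_of_card_le_one lam hcard
      rw [h0] at hB'
      simp at hB'
    have h5 : 2 ^ 5 ≤ M ^ 5 := Nat.pow_le_pow_left hM2 5
    have h2' : 2 ^ 2 ≤ M ^ 2 := Nat.pow_le_pow_left hM2 2
    have hm24 : 24 * M ^ 6 ≤ m := by
      calc 24 * M ^ 6 ≤ M ^ 5 * M ^ 6 := Nat.mul_le_mul_right _ (le_trans (by norm_num) h5)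
        _ = M ^ 11 := by ring
        _ ≤ M ^ 25 := Nat.pow_le_pow_right hM (by norm_num)
        _ ≤ m := hMm
    have hd4 : 4 * M ^ 6 < d := by
      calc 4 * M ^ 6 ≤ M ^ 2 * M ^ 6 := Nat.mul_le_mul_right _ (le_trans (by norm_num) h2')
        _ = M ^ 8 := by ring
        _ ≤ M ^ 12 := Nat.pow_le_pow_right hM (by norm_num)
        _ < d := hd12
    exact hasHighestWeight_orbitCoordRep_of_large_body_of_paddedPowerSums hf hf0 hps hM2 lam hℓ hB' hbody
      hm24 hd4

/-- **BIP Thm. 1.4 with `Ω_n` replaced by any orbit closure containing the padded power sums**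
(§2(d): "Tracing the proof reveals ..."): for `0 < n`, `n ^ 25 ≤ m`, every weight occurring in
`ℂ[\overline{GL_{m²} · X₀₀^{m-n} per_n}]` (BIP's own padding, `Complexity.bipPaddedPerOrbitRep`)
occurs in `ℂ[Δ[f]]`. Assembly as in `Complexity.bip2019_no_occurrence_obstructions_of_parts`:
Thm. 2.1 (`Complexity.bip2019_thm_2_1_holds`), the BLMW lift
(`hasHighestWeight_coordRep_of_orbitCoordRep_holds`) and the core with `M = n`.
[cite: BurgisserIkenmeyerPanovaJAMS2019, Thm. 1.4 and §2(d)] -/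
theorem hasHighestWeight_orbitCoordRep_of_bipPaddedPerOrbitRep_of_paddedPowerSums
    (hf : f.IsHomogeneous m) (hf0 : f ≠ 0)
    (hps : ∀ (s r : ℕ), s * r ≤ m → ∀ φ : Fin r → MatIdx m → ℂ,
      (X (topMatIdx m) ^ (m - s) * ∑ i, (∑ x, C (φ i x) * X x : MvPolynomial (MatIdx m) ℂ) ^ s) ∈
        orbitClosure f)
    {n : ℕ} (hn : 0 < n) (hnm : n ^ 25 ≤ m) (χ : Weight (MatIdx m))
    (h : HasHighestWeight (Complexity.bipPaddedPerOrbitRep ℂ n m) χ) :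
    HasHighestWeight (orbitCoordRep f m) χ := by
  have hnm' : n ≤ m := (Nat.le_self_pow (by norm_num) n).trans hnm
  obtain ⟨d, lam, hℓ, hbody, rfl⟩ := Complexity.bip2019_thm_2_1_holds n m hn hnm' χ h
  have hocc : HasHighestWeight (coordRep (MatIdx m) ℂ m) (partitionWeightLex m lam) :=
    hasHighestWeight_coordRep_of_orbitCoordRep_holds (Complexity.bipPaddedPerFormLex ℂ n m)
      (NeZero.ne m) (Complexity.bipPaddedPerFormLex_isHomogeneous (k := ℂ) hnm') h
  exact hasHighestWeight_orbitCoordRep_of_parts_of_paddedPowerSums hf hf0 hps hn hnm lam hℓ hbody hocc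

/-- Consistency check (not a new statement): with `f = det_m` and the tree's Thm. 2.5
(`Complexity.X_pow_mul_sum_linearFormPow_mem_orbitClosure_detFormLex`) the generic theorem
re-proves the tree's `Complexity.bip2019_no_occurrence_obstructions` (BIP Thm. 1.4 as printed). -/
example : Complexity.bip2019_no_occurrence_obstructions := fun _n m _ hn hnm χ h =>
  hasHighestWeight_orbitCoordRep_of_bipPaddedPerOrbitRep_of_paddedPowerSums
    (detFormLex_isHomogeneous ℂ m) (Complexity.detFormLex_ne_zero m)
    (fun _ _ hsr φ => Complexity.X_pow_mul_sum_linearFormPow_mem_orbitClosure_detFormLex hsr _ φ)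
    hn hnm χ h

end GenericTarget

/-! ## §7a. The power-sum orbit closure `PS_m` contains every sum of at most `m²` `m`-th powers
of linear forms -/

section PowerSumClosure

variable (m : ℕ)

/-- The power sum `X_1^m + ⋯ + X_{m²}^m` defining `PS_m` (BIP §2(d): "the power sum with `n²`
terms") is not the zero polynomial (`m ≥ 1`): its coefficient at `X_{iₘ}^m` is `1`.
[cite: BurgisserIkenmeyerPanovaJAMS2019, §2(d)] -/
theorem psFormLex_ne_zero [NeZero m] : psFormLex ℂ m ≠ 0 := by
  classical
  have iₘ : MatIdx m := Complexity.topMatIdx m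
  intro h
  have hc : coeff (Finsupp.single iₘ m) (psFormLex ℂ m) = 1 := by
    rw [psFormLex, coeff_sum, Finset.sum_eq_single iₘ]
    · rw [coeff_X_pow, if_pos rfl]
    · intro b _ hb
      rw [coeff_X_pow, if_neg]
      exact fun hbe => hb ((Finsupp.single_left_inj (NeZero.ne m)).mp hbe)
    · exact fun h => absurd (Finset.mem_univ _) h
  rw [h, coeff_zero] at hc
  exact zero_ne_one hc

/-- A linear substitution `A` applied to the power sum of the variables gives the power sum of
the columns of `A`: `A · ∑_i X_i^m = ∑_i (∑_j A_{ji} X_j)^m`. BIP §2(d) (the orbit of the power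
sum). [cite: BurgisserIkenmeyerPanovaJAMS2019, §2(d)] -/
theorem linSubst_psFormLex (A : Matrix (MatIdx m) (MatIdx m) ℂ) :
    linSubst (MatIdx m) ℂ A (psFormLex ℂ m) = ∑ i, (∑ j, A j i • X j) ^ m := by
  simp only [psFormLex, map_sum, map_pow, linSubst_X]

/-- **`PS_m` contains every sum of `m²` `m`-th powers of linear forms, with arbitrary
coefficients** (indexed by the matrix positions): `∑_i c_i ψ_i^m ∈ PS_m`. Over `ℂ` the
coefficients are absorbed as `m`-th roots, and `∑_i (c_i^{1/m} ψ_i)^m = A · (∑_i X_i^m)` for the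
matrix `A` with columns `c_i^{1/m} ψ_i` lies in `End · (∑ X_i^m) ⊆ PS_m`
(`linSubst_mem_orbitClosure`). BIP §2(d): forms of Waring rank `≤ n²` lie in `PS_n`.
[cite: BurgisserIkenmeyerPanovaJAMS2019, §2(d)] -/
theorem sum_C_mul_linearFormPow_mem_orbitClosure_psFormLex [NeZero m] (c : MatIdx m → ℂ)
    (ψ : MatIdx m → MatIdx m → ℂ) :
    (∑ i, C (c i) * (∑ x, C (ψ i x) * X x) ^ m : MvPolynomial (MatIdx m) ℂ) ∈
      orbitClosure (psFormLex ℂ m) := by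
  classical
  choose b hb using fun i => IsAlgClosed.exists_pow_nat_eq (c i) (NeZero.pos m)
  have h : linSubst (MatIdx m) ℂ (Matrix.of fun j i => b i * ψ i j) (psFormLex ℂ m) ∈
      orbitClosure (psFormLex ℂ m) :=
    endOrbit_subset_orbitClosure_holds (psFormLex ℂ m) ⟨_, rfl⟩
  rw [linSubst_psFormLex] at h
  convert h using 1
  refine Finset.sum_congr rfl fun i _ => ?_
  have hcol : (∑ j, (Matrix.of fun j i => b i * ψ i j) j i • X j : MvPolynomial (MatIdx m) ℂ) =
      C (b i) * ∑ x, C (ψ i x) * X x := by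
    rw [Finset.mul_sum]
    refine Finset.sum_congr rfl fun j _ => ?_
    rw [Matrix.of_apply, smul_eq_C_mul, map_mul, mul_assoc]
  rw [hcol, mul_pow, ← map_pow, hb i]

/-- The matrix index type has `m²` elements. [folklore] -/
private theorem card_matIdx : Fintype.card (MatIdx m) = m * m := by
  rw [← Fintype.card_congr (matIdxEquiv m).toEquiv, Fintype.card_fin]

/-- **`PS_m` contains every sum of at most `m²` `m`-th powers of linear forms** (any index type
of cardinality `≤ m²`, arbitrary coefficients): re-indexing of
`sum_C_mul_linearFormPow_mem_orbitClosure_psFormLex` along an injection into the matrix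
positions, the unused positions carrying the zero form. BIP §2(d).
[cite: BurgisserIkenmeyerPanovaJAMS2019, §2(d)] -/
theorem sum_C_mul_linearFormPow_mem_orbitClosure_psFormLex_of_card_le [NeZero m] {ι : Type*}
    [Fintype ι]
    (hι : Fintype.card ι ≤ m * m) (c : ι → ℂ) (ψ : ι → MatIdx m → ℂ) :
    (∑ a, C (c a) * (∑ x, C (ψ a x) * X x) ^ m : MvPolynomial (MatIdx m) ℂ) ∈
      orbitClosure (psFormLex ℂ m) := by
  classical
  have hcard : Fintype.card ι ≤ Fintype.card (MatIdx m) := by rwa [card_matIdx]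
  obtain ⟨e⟩ := Function.Embedding.nonempty_iff_card_le.mpr hcard
  have h := sum_C_mul_linearFormPow_mem_orbitClosure_psFormLex m (Function.extend e c 0)
    (Function.extend e ψ 0)
  convert h using 1
  rw [← Finset.sum_subset (Finset.subset_univ (Finset.univ.map e))]
  · rw [Finset.sum_map]
    refine Finset.sum_congr rfl fun a _ => ?_
    rw [e.injective.extend_apply, e.injective.extend_apply]
  · intro i _ hi
    have hi' : ¬ ∃ a, e a = i := by simpa [Finset.mem_map] using hi
    rw [Function.extend_apply' _ _ _ hi', Pi.zero_apply, map_zero, zero_mul]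

end PowerSumClosure

/-! ## §7b. The Waring decomposition of a padded power of a linear form: the roots-of-unity
filter `∑_{j<m} ζ^{j(m-s)} (x + ζ^j y)^m = m \binom{m}{s} x^{m-s} y^s` (`1 ≤ s ≤ m - 1`) -/

section Filter

/-- A power of a root of unity sums to zero over a full period unless it is `1`:
`∑_{j<m} η^j = 0` for `η^m = 1`, `η ≠ 1`. [folklore] -/
private theorem sum_pow_eq_zero_of_pow_eq_one {m : ℕ} {η : ℂ} (hηm : η ^ m = 1) (hη : η ≠ 1) :
    ∑ j : Fin m, η ^ (j : ℕ) = 0 := by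
  rw [Fin.sum_univ_eq_sum_range (fun j => η ^ j) m, geom_sum_eq hη, hηm, sub_self, zero_div]

/-- **The roots-of-unity filter behind "a padded power `X^{n-s} φ^s` has Waring rank `≤ n`"**
(BIP §2(d), arXiv v3 source l. 830–834: "`R(X^a Y^b) ≤ b+1` if `a < b`, which follows from the
identity `∑_{j=0}^{b-1} (X + ζ^j Y)^{a+b} = b X^{a+b} + b \binom{a+b}{a} X^a Y^b`, where `ζ` is a
primitive `b`th root of unity"; the variant here sums over ALL `m`-th roots of unity against the
character `ζ^{j(m-s)}`, which isolates `X^{m-s} Y^s` exactly with `m` terms — the count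
`R(X_1^{n-s} φ^s) ≤ n` used at l. 868): for `ζ` a primitive `m`-th root of unity and
`1 ≤ s ≤ m - 1`, in any commutative `ℂ`-algebra,
`∑_{j<m} ζ^{j(m-s)} (x + ζ^j y)^m = m \binom{m}{s} · x^{m-s} y^s` (expand by the binomial
theorem; the coefficient of `x^k y^{m-k}` is `\binom{m}{k} ∑_j ζ^{j((m-s)+(m-k))}`, and
`ζ^{(m-s)+(m-k)} = 1` iff `m ∣ 2m-s-k` iff `k = m-s`). [cite: BurgisserIkenmeyerPanovaJAMS2019, §2(d)] -/
theorem sum_rootOfUnity_smul_add_smul_pow {R : Type*} [CommRing R] [Algebra ℂ R] {m s : ℕ}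
    (hs : 1 ≤ s) (hsm : s < m) {ζ : ℂ} (hζ : IsPrimitiveRoot ζ m) (x y : R) :
    ∑ j : Fin m, ζ ^ ((j : ℕ) * (m - s)) • (x + ζ ^ (j : ℕ) • y) ^ m =
      ((m * m.choose s : ℕ) : ℂ) • (x ^ (m - s) * y ^ s) := by
  classical
  have hsm' : s ≤ m := hsm.le
  -- expand every term by the binomial theorem and collect the scalars
  have hterm : ∀ j : Fin m, ζ ^ ((j : ℕ) * (m - s)) • (x + ζ ^ (j : ℕ) • y) ^ m =
      ∑ k ∈ range (m + 1), (ζ ^ ((m - s) + (m - k))) ^ (j : ℕ) •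
        (x ^ k * y ^ (m - k) * (m.choose k : R)) := by
    intro j
    rw [add_pow, Finset.smul_sum]
    refine Finset.sum_congr rfl fun k _ => ?_
    rw [smul_pow, mul_smul_comm, smul_mul_assoc, smul_smul, ← pow_mul, ← pow_mul, ← pow_add]
    congr 2
    rw [Nat.mul_comm ((m - s) + (m - k)) (j : ℕ), Nat.mul_add]
  rw [Finset.sum_congr rfl fun j _ => hterm j, Finset.sum_comm]
  simp_rw [← Finset.sum_smul]
  -- only `k = m - s` survives
  rw [Finset.sum_eq_single (m - s)]
  · have hone : ζ ^ ((m - s) + (m - (m - s))) = 1 := by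
      rw [Nat.sub_sub_self hsm', Nat.sub_add_cancel hsm', hζ.pow_eq_one]
    rw [hone]
    simp only [one_pow, Finset.sum_const, Finset.card_univ, Fintype.card_fin, nsmul_eq_mul,
      mul_one]
    rw [Nat.sub_sub_self hsm', Nat.choose_symm hsm', Nat.cast_mul, mul_smul,
      Nat.cast_smul_eq_nsmul ℂ (m.choose s), nsmul_eq_mul, mul_comm (x ^ (m - s) * y ^ s)]
  · intro k hk hks
    rw [Finset.mem_range] at hk
    have hne : ζ ^ ((m - s) + (m - k)) ≠ 1 := by
      intro h1
      obtain ⟨q, hq⟩ := (hζ.pow_eq_one_iff_dvd _).mp h1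
      rcases q with _ | _ | q
      · rw [Nat.mul_zero] at hq; omega
      · rw [Nat.mul_one] at hq; omega
      · have h2 : 2 * m ≤ m * (q + 1 + 1) := by nlinarith
        omega
    have hpow : (ζ ^ ((m - s) + (m - k))) ^ m = 1 := by
      rw [← pow_mul, Nat.mul_comm, pow_mul, hζ.pow_eq_one, one_pow]
    rw [sum_pow_eq_zero_of_pow_eq_one hpow hne, zero_smul]
  · intro h
    exact absurd (Finset.mem_range.mpr (by omega)) h

end Filter

/-! ## §7c. `PS_m` contains the padded power sums (BIP §2(d): "`X_1^{n-s} p ∈ PS_n`") -/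

section PaddedPowerSums

variable {m : ℕ}

/-- The linear form `X_{iₘ} + ζ φ` written as a linear combination of the variables. [folklore] -/
private theorem sum_C_add_mul_X_eq (iₘ : MatIdx m) (ζ : ℂ) (φ : MatIdx m → ℂ) :
    (∑ x, C ((if x = iₘ then (1 : ℂ) else 0) + ζ * φ x) * X x : MvPolynomial (MatIdx m) ℂ) =
      X iₘ + ζ • ∑ x, C (φ x) * X x := by
  classical
  simp only [map_add, add_mul, Finset.sum_add_distrib, sum_C_ite_mul_X_eq, map_mul, mul_assoc,
    ← Finset.mul_sum, smul_eq_C_mul]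

/-- **BIP Thm. 2.5 with `PS_m` in place of `Ω_m`** (§2(d), arXiv p. 7: the padded power sums
`X_1^{n-s} p`, `p = φ_1^s + ⋯ + φ_k^s`, `n ≥ sk`, "have Waring rank `≤ nk ≤ n²` ... so
`X_1^{n-s} p ∈ PS_n`"): for linear forms `φ_i` (`i < r`) and `s r ≤ m`, the padded power sum
`X_{iₘ}^{m-s} · ∑_i φ_i^s` lies in `PS_m = \overline{GL_{m²} · (X_1^m + ⋯ + X_{m²}^m)}`. Proof:
for `1 ≤ s ≤ m - 1` each `X_{iₘ}^{m-s} φ_i^s` is a combination of the `m` powers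
`(X_{iₘ} + ζ^j φ_i)^m` (`sum_rootOfUnity_smul_add_smul_pow`), `r m ≤ m²` terms in all; the cases
`r = 0`, `s = 0` (`r · X_{iₘ}^m`) and `s = m` (`r ≤ 1`) are single powers; conclude by
`sum_C_mul_linearFormPow_mem_orbitClosure_psFormLex_of_card_le`.
[cite: BurgisserIkenmeyerPanovaJAMS2019, §2(d) and Thm. 2.5] -/
theorem X_pow_mul_sum_linearFormPow_mem_orbitClosure_psFormLex [NeZero m] {s r : ℕ} (h : s * r ≤ m)
    (iₘ : MatIdx m) (φ : Fin r → MatIdx m → ℂ) :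
    (X iₘ ^ (m - s) * ∑ i, (∑ x, C (φ i x) * X x : MvPolynomial (MatIdx m) ℂ) ^ s) ∈
      orbitClosure (psFormLex ℂ m) := by
  classical
  have hm1 : 1 ≤ m * m := Nat.one_le_iff_ne_zero.mpr (mul_ne_zero (NeZero.ne m) (NeZero.ne m))
  rcases Nat.eq_zero_or_pos r with rfl | hr
  · -- no terms: the zero form
    have h0 := sum_C_mul_linearFormPow_mem_orbitClosure_psFormLex m 0 fun _ _ => 0
    simp only [Pi.zero_apply, map_zero, zero_mul, Finset.sum_const_zero] at h0
    simpa using h0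
  have hsm : s ≤ m := le_trans (Nat.le_mul_of_pos_right s hr) h
  rcases Nat.eq_zero_or_pos s with rfl | hs
  · -- `s = 0`: the form is `r · X_{iₘ}^m`
    have h1 := sum_C_mul_linearFormPow_mem_orbitClosure_psFormLex_of_card_le m (ι := Fin 1)
      (by rw [Fintype.card_fin]; exact hm1) (fun _ => (r : ℂ)) fun _ x => if x = iₘ then 1 else 0
    rw [Fin.sum_univ_one, sum_C_ite_mul_X_eq, map_natCast] at h1
    simpa [mul_comm] using h1
  rcases hsm.lt_or_eq with hslt | rfl
  · -- `1 ≤ s ≤ m - 1`: the roots-of-unity filter, `r m ≤ m²` powers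
    have hrm : r ≤ m := le_trans (Nat.le_mul_of_pos_left r hs) h
    have hcard : Fintype.card (Fin r × Fin m) ≤ m * m := by
      rw [Fintype.card_prod, Fintype.card_fin, Fintype.card_fin]
      exact Nat.mul_le_mul_right m hrm
    obtain ⟨ζ, hζ⟩ : ∃ ζ : ℂ, IsPrimitiveRoot ζ m := ⟨_, Complex.isPrimitiveRoot_exp m (NeZero.ne m)⟩
    have hN : ((m * m.choose s : ℕ) : ℂ) ≠ 0 :=
      Nat.cast_ne_zero.mpr (mul_ne_zero (NeZero.ne m) (Nat.choose_pos hsm).ne')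
    have key : (X iₘ ^ (m - s) * ∑ i, (∑ x, C (φ i x) * X x : MvPolynomial (MatIdx m) ℂ) ^ s) =
        ∑ p : Fin r × Fin m, C (((m * m.choose s : ℕ) : ℂ)⁻¹ * ζ ^ ((p.2 : ℕ) * (m - s))) *
          (∑ x, C ((if x = iₘ then (1 : ℂ) else 0) + ζ ^ (p.2 : ℕ) * φ p.1 x) * X x) ^ m := by
      rw [Fintype.sum_prod_type, Finset.mul_sum]
      refine Finset.sum_congr rfl fun i _ => ?_
      have hfil := sum_rootOfUnity_smul_add_smul_pow hs hslt hζ (X iₘ)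
        (∑ x, C (φ i x) * X x : MvPolynomial (MatIdx m) ℂ)
      have hdiv : (X iₘ ^ (m - s) * (∑ x, C (φ i x) * X x : MvPolynomial (MatIdx m) ℂ) ^ s) =
          (((m * m.choose s : ℕ) : ℂ))⁻¹ • ∑ j : Fin m, ζ ^ ((j : ℕ) * (m - s)) •
            (X iₘ + ζ ^ (j : ℕ) • ∑ x, C (φ i x) * X x) ^ m := by
        rw [hfil, smul_smul, inv_mul_cancel₀ hN, one_smul]
      rw [hdiv, Finset.smul_sum]
      refine Finset.sum_congr rfl fun j _ => ?_
      rw [smul_smul, smul_eq_C_mul, sum_C_add_mul_X_eq]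
    rw [key]
    exact sum_C_mul_linearFormPow_mem_orbitClosure_psFormLex_of_card_le m hcard _ _
  · -- `s = m`: at most one term
    have hr1 : r ≤ 1 := by
      by_contra hr1
      have : s * 2 ≤ s * r := Nat.mul_le_mul_left s (by omega)
      omega
    have hcard : Fintype.card (Fin r) ≤ s * s := by rw [Fintype.card_fin]; omega
    have h1 := sum_C_mul_linearFormPow_mem_orbitClosure_psFormLex_of_card_le s (ι := Fin r) hcard
      (fun _ => 1) φ
    simpa using h1

end PaddedPowerSums

/-! ## §8. BIP Cor. 2.6 discharged -/

section Corollary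

/-- **Discharge of `bip2019_cor_2_6` — BIP Cor. 2.6 (no occurrence obstructions for Waring
rank).** "Let `n, d, m` be positive integers with `n ≥ m^{25}` and `λ ⊢ nd`. If `λ` occurs in
`ℂ[Z_{n,m}]`, then `λ` also occurs in `ℂ[PS_n]`" (J. AMS 32 (2019), §2(d), arXiv v3 p. 7), in the
rendering of `ObstructionTypes.lean` (permanent `n`, power-sum size `m`, `n ^ 25 ≤ m`, `0 < n`,
weight form, BIP's padded permanent `Complexity.bipPaddedPerOrbitRep`, `ℂ[PS_m] =
orbitCoordRep (psFormLex ℂ m) m`). Proof as printed: BIP's proof of Thm. 1.4 run with `PS_m` in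
place of `Ω_m` (`hasHighestWeight_orbitCoordRep_of_bipPaddedPerOrbitRep_of_paddedPowerSums`), the
one property of `Ω_m` it uses — containing the padded power sums, Thm. 2.5 — holding for `PS_m`
by `X_pow_mul_sum_linearFormPow_mem_orbitClosure_psFormLex` ("`X_1^{n-s} p ∈ PS_n`").
[cite: BurgisserIkenmeyerPanovaJAMS2019, Cor. 2.6] -/
theorem bip2019_cor_2_6_holds : bip2019_cor_2_6 := fun _n m _ hn hnm χ h =>
  hasHighestWeight_orbitCoordRep_of_bipPaddedPerOrbitRep_of_paddedPowerSums
    (psFormLex_isHomogeneous m) (psFormLex_ne_zero m)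
    (fun _ _ hsr φ => X_pow_mul_sum_linearFormPow_mem_orbitClosure_psFormLex hsr _ φ) hn hnm χ h

/-- **No occurrence obstruction against BIP's padded permanent in the power-sum model, for
`0 < n`, `n ^ 25 ≤ m` — unconditionally** (`ObstructionTypes.lean`'s
`not_isOccurrenceObstructionAt_ps_of_bip2019_cor_2_6` fed with `bip2019_cor_2_6_holds` and the
tree's finite-dimensionality of highest-weight spaces). BIP §2(d): "the strategy of occurrence
obstructions cannot even be used in the weaker model of `PS_n` against padded polynomials."
[cite: BurgisserIkenmeyerPanovaJAMS2019, Cor. 2.6] -/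
theorem not_isOccurrenceObstructionAt_ps_holds {n m : ℕ} [NeZero m] (hn : 0 < n)
    (hnm : n ^ 25 ≤ m) (χ : Weight (MatIdx m)) :
    ¬ IsOccurrenceObstructionAt (psFormLex ℂ m) (Complexity.bipPaddedPerFormLex ℂ n m) m χ :=
  not_isOccurrenceObstructionAt_ps_of_bip2019_cor_2_6 bip2019_cor_2_6_holds
    (fun _ => finiteDimensional_highestWeightSpace_orbitCoordRep_holds) hn hnm χ

end Corollary

/-! ## §9. What remains after BIP, unconditionally (the two census statements of
`ObstructionTypes.lean` with their named-fact hypotheses discharged) -/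

section Remaining

/-- **What Thm. 1.4 leaves, unconditionally.** For `0 < n`, `n ^ 25 ≤ m`, every multiplicity
obstruction `χ` against BIP's padded permanent `X₀₀^{m-n} per_n` lying in `Δ(det_m)` — should one
exist, which is OPEN — is a vanishing ideal occurrence obstruction or a pure multiplicity
obstruction, never an occurrence obstruction: `ObstructionTypes.lean`'s census statement
`bip2019_remaining_obstruction_types` with its three hypotheses fed by the tree's discharges
`Complexity.bip2019_no_occurrence_obstructions_holds` (BIP Thm. 1.4),
`finiteDimensional_highestWeightSpace_orbitCoordRep_holds` and
`orbitMultiplicity_le_plethysmCoeff_holds` (BLMW's bound). BIP §1.4 "Future directions" (arXiv v3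
p. 5): "While our main result, Theorem 1.4, rules out the possibility of proving the Conjecture 1.2
via occurrence obstructions, there still remains the possibility that one may succeed so by
comparing multiplicities." [cite: BurgisserIkenmeyerPanovaJAMS2019, Thm. 1.4 and §1.4] -/
theorem bip2019_remaining_obstruction_types' {n m : ℕ} [NeZero m] (hn : 0 < n) (hnm : n ^ 25 ≤ m)
    (χ : Weight (MatIdx m))
    (h : IsMultiplicityObstructionAt (detFormLex ℂ m) (Complexity.bipPaddedPerFormLex ℂ n m) m χ) :
    IsVanishingIdealOccurrenceObstructionAt (detFormLex ℂ m) (Complexity.bipPaddedPerFormLex ℂ n m) m χ ∨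
      IsPureMultiplicityObstructionAt (detFormLex ℂ m) (Complexity.bipPaddedPerFormLex ℂ n m) m χ :=
  bip2019_remaining_obstruction_types Complexity.bip2019_no_occurrence_obstructions_holds
    (fun _ => finiteDimensional_highestWeightSpace_orbitCoordRep_holds)
    (fun _ => orbitMultiplicity_le_plethysmCoeff_holds) hn hnm χ h

/-- **What Cor. 2.6 leaves in the power-sum model, unconditionally** (census row "occurrence DEAD,
multiplicity OPEN" for `PS_m`). For `0 < n`, `n ^ 25 ≤ m`, every multiplicity obstruction `χ`
against BIP's padded permanent lying in `PS_m = Δ(X_1^m + ⋯ + X_{m²}^m)` — should one exist, which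
is open in print — is a vanishing ideal occurrence obstruction or a pure multiplicity obstruction:
`ObstructionTypes.lean`'s `bip2019_remaining_obstruction_types_ps` fed with `bip2019_cor_2_6_holds`
(this file), `finiteDimensional_highestWeightSpace_orbitCoordRep_holds` and
`orbitMultiplicity_le_plethysmCoeff_holds`. BIP §2(d) (arXiv v3 p. 7): "the strategy of occurrence
obstructions cannot even be used in the weaker model of `PS_n` against padded polynomials."
[cite: BurgisserIkenmeyerPanovaJAMS2019, Cor. 2.6] -/
theorem bip2019_remaining_obstruction_types_ps' {n m : ℕ} [NeZero m] (hn : 0 < n)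
    (hnm : n ^ 25 ≤ m) (χ : Weight (MatIdx m))
    (h : IsMultiplicityObstructionAt (psFormLex ℂ m) (Complexity.bipPaddedPerFormLex ℂ n m) m χ) :
    IsVanishingIdealOccurrenceObstructionAt (psFormLex ℂ m) (Complexity.bipPaddedPerFormLex ℂ n m) m χ ∨
      IsPureMultiplicityObstructionAt (psFormLex ℂ m) (Complexity.bipPaddedPerFormLex ℂ n m) m χ :=
  bip2019_remaining_obstruction_types_ps bip2019_cor_2_6_holds
    (fun _ => finiteDimensional_highestWeightSpace_orbitCoordRep_holds)
    (fun _ => orbitMultiplicity_le_plethysmCoeff_holds) hn hnm χ h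

end Remaining

end Literature.Computability.AlgebraicComplexity
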